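import Mathlib
import Literature.RingTheory.KrullDimension.AffineDimension
import Summits.Langlands.Langlands.Theorems.SkinnerWilesDefectOneReducibleOrdinaryProModularCohenMacaulayConnectedness

/-!
# Crossing-connectedness descends along injective integral extensions — sub-goal (G2) of stub (R)

Route `SkinnerWilesDefectOne`, crux `ReducibleOrdinaryProModular` (stmt-Langlands-12919), line
`fine-selmer-codimension-two`, registered stub (R) `stub_raynaudConnectedness` (Grothendieck's
connectedness theorem [SGA2 XIII 2.1] in CROSSING FORM: for every two-colouring of the minimal primes
using both colours, two minimal primes `C₁, C₂` of different colours have `n ≤ dim R/(C₁ + C₂)`), and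
its registered sub-goal (G2) `stub_raynaudConnectedness_auxIntegralTransfer`, the transfer step of the
lead's programme (used with `D'` the reflexive hull of the complete local domain `D`):

* **crossing-connectedness in dimension `n` descends along an injective integral extension.**  Let
  `D → D'` be injective and integral, `I` an ideal of `D` and `J = I D'`.  If `Spec (D'/J)` is connected
  in dimension `n` in crossing form, so is `Spec (D/I)`.

Proof (elementary; SGA2 XIII §2 / Brodmann–Sharp 19.2 prove such transfers with local cohomology, we
do not): write `φ : D/I → D'/J` for the induced (integral) map and pull a colouring `S` of `Spec (D/I)`
back to `S' = {P | some minimal C ∈ S lies below φ⁻¹ P}`.  Lying over along `D → D'` and minimality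
show that every minimal prime of `D/I` is `φ⁻¹` of a minimal prime of `D'/J`
(`Theorems.exists_minimalPrimes_under_eq_of_isIntegral`), so both colours of `S'` occur among the
minimal primes of `D'/J`; the hypothesis gives minimal `P₁ ∈ S'`, `P₂ ∉ S'` with
`n ≤ dim (D'/J)/(P₁ + P₂)`.  Then a minimal `C_a ∈ S` lies below `φ⁻¹ P₁`, any minimal `C_b` below
`φ⁻¹ P₂` is not in `S`, and `C_a + C_b ≤ φ⁻¹(P₁ + P₂)`; since
`(D/I)/φ⁻¹(P₁ + P₂) ↪ (D'/J)/(P₁ + P₂)` is injective and integral the two have the same dimension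
(tree `Literature.RingTheory.KrullDimension.ringKrullDim_eq_of_isIntegral`), whence
`n ≤ dim (D/I)/(C_a + C_b)`.  The registered hypotheses "`D`, `D'` domains", "`n ≤ e`" and
"components of `D'/J` have dimension `≥ e`" are not needed for this direction and are not used.

References: A. Grothendieck, SGA 2, Exp. XIII §2 [Grothendieck1968SGA2]; H. Matsumura, *Commutative
Ring Theory*, Thm. 9.3, 9.4 (lying over, going up, `dim` under integral extensions) [Matsumura1987].
-/

set_option linter.dupNamespace false -- project-wide option (lakefile weak.linter.dupNamespace); `Summit.Langlands.Langlands` is the mandated namespace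
set_option autoImplicit false

namespace Summit.Langlands.Langlands.Theorems

universe u v

/-! ## 1. Integral extensions: quotient dimensions and lying over for `D/I → D'/ID'` -/

/-- **Dimension of quotients along an integral extension.**  For an integral algebra `A` over `R` and
an ideal `J` of `A`, the induced extension `R/(J ∩ R) ↪ A/J` is injective and integral, hence
`dim R/(J ∩ R) = dim A/J` (Matsumura Thm. 9.3–9.4; tree `ringKrullDim_eq_of_isIntegral`).
[folklore] -/
theorem ringKrullDim_quotient_under_eq_of_isIntegral {R : Type u} {A : Type v} [CommRing R]
    [CommRing A] [Algebra R A] [Algebra.IsIntegral R A] (J : Ideal A) :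
    ringKrullDim (R ⧸ J.under R) = ringKrullDim (A ⧸ J) :=
  Literature.RingTheory.KrullDimension.ringKrullDim_eq_of_isIntegral
    (R := R ⧸ J.under R) (S := A ⧸ J) Ideal.algebraMap_quotient_injective

/-- For an integral algebra `D'` over `D` and an ideal `I` of `D`, the induced algebra
`D/I → D'/ID'` is integral. [folklore] -/
theorem isIntegral_quotientMapQuotient {D : Type u} {D' : Type v} [CommRing D] [CommRing D']
    [Algebra D D'] [Algebra.IsIntegral D D'] (I : Ideal D) :
    Algebra.IsIntegral (D ⧸ I) (D' ⧸ I.map (algebraMap D D')) :=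
  Algebra.IsIntegral.tower_top (R := D)

/-- **Lying over for `D/I → D'/ID'`.**  If `D → D'` is injective and integral and `I` is an ideal of
`D`, every prime of `D/I` is the contraction of a prime of `D'/ID'`: lift the prime `P ⊇ I` of `D` to
a prime `Q` of `D'` lying over it (Mathlib `Ideal.exists_ideal_over_prime_of_isIntegral`); then
`ID' ≤ PD' ≤ Q` and `Q/ID'` contracts to `P/I`. [folklore] -/
theorem exists_under_eq_of_isIntegral {D : Type u} {D' : Type v} [CommRing D] [CommRing D']
    [Algebra D D'] [Algebra.IsIntegral D D'] (hinj : Function.Injective (algebraMap D D'))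
    (I : Ideal D) (C : PrimeSpectrum (D ⧸ I)) :
    ∃ Q : PrimeSpectrum (D' ⧸ I.map (algebraMap D D')), Q.asIdeal.under (D ⧸ I) = C.asIdeal := by
  -- the prime `P = C ∩ D ⊇ I` of `D`
  have hIP : I ≤ C.asIdeal.comap (Ideal.Quotient.mk I) := fun x hx => by
    rw [Ideal.mem_comap, Ideal.Quotient.eq_zero_iff_mem.mpr hx]
    exact zero_mem _
  -- lying over along `D → D'`
  obtain ⟨Q', -, hQ', hQ'P⟩ := Ideal.exists_ideal_over_prime_of_isIntegral
    (C.asIdeal.comap (Ideal.Quotient.mk I)) (⊥ : Ideal D')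
    (by rw [Ideal.comap_bot_of_injective _ hinj]; exact bot_le)
  have hJQ' : I.map (algebraMap D D') ≤ Q' := Ideal.map_le_iff_le_comap.mpr (hQ'P.symm ▸ hIP)
  have hker : RingHom.ker (Ideal.Quotient.mk (I.map (algebraMap D D'))) ≤ Q' := by
    rw [Ideal.mk_ker]; exact hJQ'
  haveI hQ : (Q'.map (Ideal.Quotient.mk (I.map (algebraMap D D')))).IsPrime :=
    Ideal.map_isPrime_of_surjective Ideal.Quotient.mk_surjective hker
  refine ⟨⟨Q'.map (Ideal.Quotient.mk (I.map (algebraMap D D'))), hQ⟩, ?_⟩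
  -- compare after pulling back along the surjection `D → D/I`
  apply Ideal.comap_injective_of_surjective (Ideal.Quotient.mk I) Ideal.Quotient.mk_surjective
  rw [Ideal.under_def, Ideal.comap_comap,
    show (algebraMap (D ⧸ I) (D' ⧸ I.map (algebraMap D D'))).comp (Ideal.Quotient.mk I) =
        (Ideal.Quotient.mk (I.map (algebraMap D D'))).comp (algebraMap D D') from
      RingHom.ext fun _ => rfl,
    ← Ideal.comap_comap, Ideal.comap_map_of_surjective _ Ideal.Quotient.mk_surjective,
    ← RingHom.ker_eq_comap_bot, Ideal.mk_ker, sup_eq_left.mpr hJQ', hQ'P]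

/-- **Minimal primes of `D/I` are contractions of minimal primes of `D'/ID'`** (`D → D'` injective and
integral): lift a minimal prime `C` of `D/I` to a prime `Q` of `D'/ID'` over it
(`exists_under_eq_of_isIntegral`) and shrink `Q` to a minimal prime `Q₀ ≤ Q`; its contraction is a
prime below `C`, hence equals `C`. [folklore] -/
theorem exists_minimalPrimes_under_eq_of_isIntegral {D : Type u} {D' : Type v} [CommRing D]
    [CommRing D'] [Algebra D D'] [Algebra.IsIntegral D D']
    (hinj : Function.Injective (algebraMap D D')) (I : Ideal D) (C : PrimeSpectrum (D ⧸ I))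
    (hC : C.asIdeal ∈ minimalPrimes (D ⧸ I)) :
    ∃ Q : PrimeSpectrum (D' ⧸ I.map (algebraMap D D')),
      Q.asIdeal ∈ minimalPrimes (D' ⧸ I.map (algebraMap D D')) ∧
        Q.asIdeal.under (D ⧸ I) = C.asIdeal := by
  obtain ⟨Q, hQ⟩ := exists_under_eq_of_isIntegral hinj I C
  obtain ⟨q, hq, hqQ⟩ :=
    Ideal.exists_minimalPrimes_le (show (⊥ : Ideal (D' ⧸ I.map (algebraMap D D'))) ≤ Q.asIdeal from
      bot_le)
  haveI : q.IsPrime := hq.1.1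
  refine ⟨⟨q, hq.1.1⟩, hq, ?_⟩
  have hle : q.under (D ⧸ I) ≤ C.asIdeal := hQ ▸ Ideal.comap_mono hqQ
  exact le_antisymm hle (hC.2 ⟨Ideal.comap_isPrime _ q, bot_le⟩ hle)

/-! ## 2. Descent of crossing-connectedness -/

/-- **Crossing-connectedness in dimension `n` descends along an injective integral extension.**  Let
`D → D'` be injective and integral, `I` an ideal of `D`, `J = ID'`.  If for every two-colouring of the
minimal primes of `D'/J` using both colours two minimal primes `P₁, P₂` of different colours have
`n ≤ dim (D'/J)/(P₁ + P₂)`, then the same holds for `D/I`.  Proof: pull the colouring `S` back to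
`S' = {P | some minimal C ∈ S lies below φ⁻¹ P}` (`φ : D/I → D'/J`); both colours occur
(`exists_minimalPrimes_under_eq_of_isIntegral`); for the resulting `P₁ ∈ S'`, `P₂ ∉ S'` a minimal
`C_a ∈ S` lies below `φ⁻¹ P₁`, any minimal `C_b` below `φ⁻¹ P₂` is outside `S`, and
`dim (D/I)/(C_a + C_b) ≥ dim (D/I)/φ⁻¹(P₁ + P₂) = dim (D'/J)/(P₁ + P₂) ≥ n`
(`ringKrullDim_quotient_under_eq_of_isIntegral`). [folklore] -/
theorem crossing_of_isIntegral {D : Type u} {D' : Type v} [CommRing D] [CommRing D']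
    [Algebra D D'] [Algebra.IsIntegral D D'] (hinj : Function.Injective (algebraMap D D'))
    (I : Ideal D) (n : WithBot ℕ∞)
    (h : ∀ S' : Set (PrimeSpectrum (D' ⧸ I.map (algebraMap D D'))),
      (∃ C ∈ S', C.asIdeal ∈ minimalPrimes (D' ⧸ I.map (algebraMap D D'))) →
      (∃ C ∉ S', C.asIdeal ∈ minimalPrimes (D' ⧸ I.map (algebraMap D D'))) →
        ∃ C₁ ∈ S', ∃ C₂ ∉ S', C₁.asIdeal ∈ minimalPrimes (D' ⧸ I.map (algebraMap D D')) ∧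
          C₂.asIdeal ∈ minimalPrimes (D' ⧸ I.map (algebraMap D D')) ∧
          n ≤ ringKrullDim ((D' ⧸ I.map (algebraMap D D')) ⧸ (C₁.asIdeal ⊔ C₂.asIdeal)))
    (S : Set (PrimeSpectrum (D ⧸ I))) (h₁ : ∃ C ∈ S, C.asIdeal ∈ minimalPrimes (D ⧸ I))
    (h₂ : ∃ C ∉ S, C.asIdeal ∈ minimalPrimes (D ⧸ I)) :
    ∃ C₁ ∈ S, ∃ C₂ ∉ S, C₁.asIdeal ∈ minimalPrimes (D ⧸ I) ∧ C₂.asIdeal ∈ minimalPrimes (D ⧸ I) ∧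
      n ≤ ringKrullDim ((D ⧸ I) ⧸ (C₁.asIdeal ⊔ C₂.asIdeal)) := by
  haveI := isIntegral_quotientMapQuotient (D := D) (D' := D') I
  obtain ⟨C₁, hC₁S, hC₁⟩ := h₁
  obtain ⟨C₂, hC₂S, hC₂⟩ := h₂
  obtain ⟨Q₁, hQ₁, hQ₁eq⟩ := exists_minimalPrimes_under_eq_of_isIntegral hinj I C₁ hC₁
  obtain ⟨Q₂, hQ₂, hQ₂eq⟩ := exists_minimalPrimes_under_eq_of_isIntegral hinj I C₂ hC₂
  -- the pulled-back colouring of `Spec (D'/ID')`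
  let S' : Set (PrimeSpectrum (D' ⧸ I.map (algebraMap D D'))) :=
    {P | ∃ C ∈ S, C.asIdeal ∈ minimalPrimes (D ⧸ I) ∧ C.asIdeal ≤ P.asIdeal.under (D ⧸ I)}
  have h₁' : Q₁ ∈ S' := ⟨C₁, hC₁S, hC₁, hQ₁eq.ge⟩
  have h₂' : Q₂ ∉ S' := by
    rintro ⟨C, hCS, -, hle⟩
    rw [hQ₂eq] at hle
    exact hC₂S (PrimeSpectrum.eq_of_mem_minimalPrimes_of_le hC₂ hle ▸ hCS)
  obtain ⟨P₁, hP₁S, P₂, hP₂S, -, -, hdim⟩ := h S' ⟨Q₁, h₁', hQ₁⟩ ⟨Q₂, h₂', hQ₂⟩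
  obtain ⟨Ca, hCaS, hCa, hCale⟩ := hP₁S
  -- a minimal prime below `φ⁻¹ P₂` is outside `S`
  obtain ⟨q, hq, hqle⟩ :=
    Ideal.exists_minimalPrimes_le (show (⊥ : Ideal (D ⧸ I)) ≤ P₂.asIdeal.under (D ⧸ I) from bot_le)
  let Cb : PrimeSpectrum (D ⧸ I) := ⟨q, hq.1.1⟩
  have hCbS : Cb ∉ S := fun hS => hP₂S ⟨Cb, hS, hq, hqle⟩
  refine ⟨Ca, hCaS, Cb, hCbS, hCa, hq, hdim.trans ?_⟩
  have hle : Ca.asIdeal ⊔ Cb.asIdeal ≤ (P₁.asIdeal ⊔ P₂.asIdeal).under (D ⧸ I) :=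
    sup_le (hCale.trans (Ideal.comap_mono le_sup_left)) (hqle.trans (Ideal.comap_mono le_sup_right))
  rw [← ringKrullDim_quotient_under_eq_of_isIntegral (R := D ⧸ I) (P₁.asIdeal ⊔ P₂.asIdeal)]
  exact ringKrullDim_quotient_anti hle

end Summit.Langlands.Langlands.Theorems

/-! ## 3. The registered sub-goal (verbatim signature) -/

namespace Summit.Langlands.Langlands.Cruxes.ReducibleOrdinaryProModular.FineSelmerCodimensionTwo

/-- **Registered sub-goal (G2) `stub_raynaudConnectedness_auxIntegralTransfer` of stub (R)
`stub_raynaudConnectedness`**: crossing-connectedness in dimension `n` of `Spec (D'/ID')` descends to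
`Spec (D/I)` along an injective integral extension of domains `D → D'` — the transfer step (to the
reflexive hull `D'` of `D`) in the lead's proof of Grothendieck's connectedness theorem
[SGA2 XIII 2.1].  This is `Theorems.crossing_of_isIntegral`; the hypotheses `n ≤ e` and "every
irreducible component of `Spec (D'/ID')` has dimension `≥ e`" of the registered signature are not
needed and not used. [cite: Grothendieck1968SGA2, Exp. XIII §2] -/
theorem stub_raynaudConnectedness_auxIntegralTransfer :
    ∀ (D : Type) [CommRing D] [IsDomain D] (D' : Type) [CommRing D'] [IsDomain D'] [Algebra D D']
      [Algebra.IsIntegral D D'], Function.Injective (algebraMap D D') → ∀ (I : Ideal D) (n e : ℕ),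
      n ≤ e → (∀ Q : Ideal (D' ⧸ I.map (algebraMap D D')),
        Q ∈ minimalPrimes (D' ⧸ I.map (algebraMap D D')) →
          (e : WithBot ℕ∞) ≤ ringKrullDim ((D' ⧸ I.map (algebraMap D D')) ⧸ Q)) →
      (∀ S : Set (PrimeSpectrum (D' ⧸ I.map (algebraMap D D'))),
        (∃ C ∈ S, C.asIdeal ∈ minimalPrimes (D' ⧸ I.map (algebraMap D D'))) →
        (∃ C ∉ S, C.asIdeal ∈ minimalPrimes (D' ⧸ I.map (algebraMap D D'))) →
          ∃ C₁ ∈ S, ∃ C₂ ∉ S, C₁.asIdeal ∈ minimalPrimes (D' ⧸ I.map (algebraMap D D')) ∧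
            C₂.asIdeal ∈ minimalPrimes (D' ⧸ I.map (algebraMap D D')) ∧
            (n : WithBot ℕ∞) ≤
              ringKrullDim ((D' ⧸ I.map (algebraMap D D')) ⧸ (C₁.asIdeal ⊔ C₂.asIdeal))) →
      ∀ S : Set (PrimeSpectrum (D ⧸ I)), (∃ C ∈ S, C.asIdeal ∈ minimalPrimes (D ⧸ I)) →
        (∃ C ∉ S, C.asIdeal ∈ minimalPrimes (D ⧸ I)) →
          ∃ C₁ ∈ S, ∃ C₂ ∉ S, C₁.asIdeal ∈ minimalPrimes (D ⧸ I) ∧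
            C₂.asIdeal ∈ minimalPrimes (D ⧸ I) ∧
            (n : WithBot ℕ∞) ≤ ringKrullDim ((D ⧸ I) ⧸ (C₁.asIdeal ⊔ C₂.asIdeal)) :=
  fun _ _ _ _ _ _ _ _ hinj I n _ _ _ hcross S h₁ h₂ =>
    Summit.Langlands.Langlands.Theorems.crossing_of_isIntegral hinj I n hcross S h₁ h₂

end Summit.Langlands.Langlands.Cruxes.ReducibleOrdinaryProModular.FineSelmerCodimensionTwo
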